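import Summits.QuantumAdvantage.QuantumAdvantage.Theorems.CertDialD
import HarnessLib

/-!
# CertDial (E) — decomp-qadv lens-2 (structural dichotomy: special vs generic), generation 28, part 5/5

Part 5 of NODE «CertDial» (memo in part A's header and `NODE-g28.md`): §7 THE CERTIFICATE LAWS AGAINST THE GENERIC CLASSES PROPER.  The generic
leaves `PGlobalFail 2 D w` / `OGlobalFail 2 D w` quantify over degree-`≤ D` strategies that are NOT parity-local (even `n`) / NOT offset-comb-local
(odd `n`); a certificate against them may use special strategies' losses for free, so Theorems A and B′ (parts A–C, stated for the full degree classes)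
are re-proved here with witnesses visibly OUTSIDE both special classes — strategies that SPLIT AT ZERO (`SplitAtZero`: on the all-`0` input two positions
of equal parity answer differently; every window and comb count is trivial there, so no parity-local / offset-comb-local strategy splits at zero:
`not_isParityLocal_of_split`, `not_isOffsetCombLocal_of_split'`).  ★ `winParity_attains_split` / `xorCertificate_trivial_parity` /
`xorCertificate_trivial_comb` (THEOREM A′: for `n ≥ 5`, `D ≥ 1` the win/loss vectors of the degree-`≤ D` strategies splitting at zero lie in no proper
affine subspace — NO XOR CERTIFICATE, in particular `no_universal_input_split`: NO UNIVERSAL INPUT, against either generic class, any radius);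
★★ `no_bounded_universal_family_split` / `generic_no_bounded_witness_parity` / `generic_no_bounded_witness_comb` (THEOREM B′ for the generic classes:
for `n ≥ (M·w+1)(2M+1)`, `n ≥ 2M+4`, any `M` odd-class inputs of weight `≤ w` are won by ONE degree-`≤ D` strategy that is not offset-comb-local and,
for even `n`, not parity-local — NO BOUNDED UNIVERSAL FAMILY against either generic leaf, at any weight).  Nothing here proves or refutes the generic
leaves or 27432.  `lean check` (own closure) rc 0 · 0 sorry · 0 warning; axioms standard.
-/

set_option linter.dupNamespace false
set_option linter.style.longLine false

noncomputable section
open scoped Classical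

namespace Summit.QuantumAdvantage.QuantumAdvantage.Theorems.CertDial
open Finset
open Literature.Computability.QuantumComplexity Literature.Computability.QuantumComplexity.RingHLF
open Summit.QuantumAdvantage.AdviceFreeQNC0
open Literature.Computability.MetaComplexity Literature.Computability.MetaComplexity.Smolensky
open Summit.QuantumAdvantage.QuantumAdvantage.Theorems.RingPeriodFold
  (kvec kernel_pair_of_oddZeros kvec_ne_zero rel_iff_of_kernel_pair)
open Summit.QuantumAdvantage.QuantumAdvantage.Theorems.LightDial (wt lightLosing LightFail mono_singleton_apply)
open Summit.QuantumAdvantage.QuantumAdvantage.Theorems.ParityDial (PGlobalFail OGlobalFail PLocalFail IsParityLocal par ecntOff ocntOff)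
open Summit.QuantumAdvantage.AdviceFreeQNC0.LightConeWindowHard (window)
open Summit.QuantumAdvantage.QuantumAdvantage.Theses.ExactnessDial (NoPerfectTwo3)

variable {n : ℕ}

open Summit.QuantumAdvantage.QuantumAdvantage.Theorems.ParityDial (OffsetCombFail IsOffsetCombLocal)
open Summit.QuantumAdvantage.AdviceFreeQNC0.RingSymmetry (shift rot_apply rel_rot card_filter_shift)

/-! ## §7 The same certificates against the GENERIC classes PROPER (Theorems A and B′ with non-special witnesses)

The generic leaves quantify over degree-`≤ D` strategies that are NOT parity-local (even `n`) / NOT offset-comb-local (odd `n`).  A certificate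
against the generic class may use special strategies' losses for free, so §2–§3 are re-proved with witnesses that visibly lie OUTSIDE both special
classes: they SPLIT AT ZERO — on the all-`0` input two positions of equal parity answer differently (every window and every comb count is trivial
there, so no input-wise special class contains them). -/

/-- the all-zero input. -/
def zer (n : ℕ) : Fin n → Bool := fun _ => false

/-- `P` SPLITS AT ZERO (without parity): two positions answer the all-zero input differently. -/
def SplitAtZero' (P : Fin n → CubeFn (ZMod 3) n) : Prop := ∃ i j : Fin n, P i (zer n) = 1 ∧ P j (zer n) ≠ 1

/-- `P` SPLITS AT ZERO: two positions OF EQUAL PARITY answer the all-zero input differently. -/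
def SplitAtZero (P : Fin n → CubeFn (ZMod 3) n) : Prop := ∃ i j : Fin n, par i = par j ∧ P i (zer n) = 1 ∧ P j (zer n) ≠ 1

/-- the parity-free form is weaker. -/
theorem splitAtZero'_of_splitAtZero {P : Fin n → CubeFn (ZMod 3) n} (h : SplitAtZero P) : SplitAtZero' P := by
  obtain ⟨i, j, _, hi, hj⟩ := h; exact ⟨i, j, hi, hj⟩

/-- all windows of the zero input coincide. -/
theorem window_zer (r : ℕ) (i j : Fin n) : window r (zer n) i = window r (zer n) j := rfl

/-- all even comb counts of the zero input vanish. -/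
theorem ecntOff_zer (i : Fin n) : ecntOff i (zer n) = 0 := by simp [ecntOff, zer]

/-- all odd comb counts of the zero input vanish. -/
theorem ocntOff_zer (i : Fin n) : ocntOff i (zer n) = 0 := by simp [ocntOff, zer]

/-- a strategy that splits at zero is NOT parity-local, at any radius. -/
theorem not_isParityLocal_of_split {P : Fin n → CubeFn (ZMod 3) n} (h : SplitAtZero P) (r : ℕ) : ¬ IsParityLocal r P := by
  obtain ⟨i, j, hp, hi, hj⟩ := h
  exact fun hP => hj (((hP (zer n) i j hp (window_zer r i j)).1) hi)

/-- a strategy that splits at zero (parity-free form) is NOT offset-comb-local, at any radius. -/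
theorem not_isOffsetCombLocal_of_split' {P : Fin n → CubeFn (ZMod 3) n} (h : SplitAtZero' P) (r : ℕ) : ¬ IsOffsetCombLocal r P := by
  obtain ⟨i, j, hi, hj⟩ := h
  refine fun hP => hj ((hP (zer n) i j (window_zer r i j) ?_ ?_).1 hi)
  · rw [ecntOff_zer, ecntOff_zer]
  · rw [ocntOff_zer, ocntOff_zer]

/-! ### §7a Theorem A against the generic classes -/

/-- the two-row strategy: row `R₀` at `t₀`, row `R₁` at `t₁`, zero elsewhere. -/
def twoRow (t₀ t₁ : Fin n) (R₀ R₁ : CubeFn (ZMod 3) n) : Fin n → CubeFn (ZMod 3) n :=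
  fun i => if i = t₀ then R₀ else if i = t₁ then R₁ else 0

/-- degree of the two-row strategy. -/
theorem twoRow_mem {D : ℕ} (t₀ t₁ : Fin n) {R₀ R₁ : CubeFn (ZMod 3) n} (h₀ : R₀ ∈ lowDeg (ZMod 3) n D) (h₁ : R₁ ∈ lowDeg (ZMod 3) n D)
    (i : Fin n) : twoRow t₀ t₁ R₀ R₁ i ∈ lowDeg (ZMod 3) n D := by
  unfold twoRow; split_ifs
  · exact h₀
  · exact h₁
  · exact Submodule.zero_mem _

/-- the kernel pairing of the two-row strategy is the sum of the two answer bits seen by the kernel vector. -/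
theorem dz_ans_twoRow (v x : Fin n → Bool) {t₀ t₁ : Fin n} (ht : t₀ ≠ t₁) (R₀ R₁ : CubeFn (ZMod 3) n) :
    dz v (ans (twoRow t₀ t₁ R₀ R₁) x) = (if v t₀ = true then 1 else 0) * lev R₀ x + (if v t₁ = true then 1 else 0) * lev R₁ x := by
  unfold dz ans twoRow lev
  have : ∀ b : Fin n, (if v b = true ∧ decide ((if b = t₀ then R₀ else if b = t₁ then R₁ else 0) x = 1) = true then (1 : ZMod 2) else 0) =
      (if b = t₀ then (if v t₀ = true then 1 else 0) * (if R₀ x = 1 then 1 else 0) else 0) +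
      (if b = t₁ then (if v t₁ = true then 1 else 0) * (if R₁ x = 1 then 1 else 0) else 0) := by
    intro b
    by_cases hb : b = t₀
    · subst hb
      by_cases hv : v b = true <;> by_cases hR : R₀ x = 1 <;> simp [hv, hR, ht]
    · by_cases hb' : b = t₁
      · subst hb'
        by_cases hv : v b = true <;> by_cases hR : R₁ x = 1 <;> simp [hv, hR, hb]
      · simp [hb, hb']
  rw [Finset.sum_congr rfl fun b _ => this b, Finset.sum_add_distrib, Finset.sum_ite_eq', Finset.sum_ite_eq']; simp

/-- three distinct EVEN positions `0, 2, 4` (for `n ≥ 5`). -/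
theorem three_even (hn : 5 ≤ n) : ∃ e₀ e₁ e₂ : Fin n, par e₀ = par e₁ ∧ par e₀ = par e₂ ∧ e₀ ≠ e₁ ∧ e₀ ≠ e₂ ∧ e₁ ≠ e₂ := by
  refine ⟨⟨0, by omega⟩, ⟨2, by omega⟩, ⟨4, by omega⟩, ?_, ?_, ?_, ?_, ?_⟩ <;> simp [par, Fin.ext_iff]

/-- ★ THEOREM A′ (no XOR certificate against the GENERIC classes): for `n ≥ 5`, `D ≥ 1`, every nonzero `μ` on the odd class and every `β`
there is a degree-`≤ D` strategy that SPLITS AT ZERO (hence is neither parity-local nor offset-comb-local, any radius) with `μ`-weighted win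
parity `β`.  Witnesses: the constant-`1` row at an even position `t₀`, and the same plus one affine row at a support position `t₁` of a charged
kernel vector. -/
theorem winParity_attains_split (hn : 5 ≤ n) {D : ℕ} (hD : 1 ≤ D) (μ : BFn n) (hμ : ∀ x, μ x ≠ 0 → OddZeros x)
    (hne : μ ≠ 0) (β : ZMod 2) :
    ∃ P : Fin n → CubeFn (ZMod 3) n, (∀ i, P i ∈ lowDeg (ZMod 3) n D) ∧ SplitAtZero P ∧ ∑ x, μ x * win P x = β := by
  have hn3 : 3 ≤ n := by omega
  obtain ⟨x₀, hx₀⟩ : ∃ x₀, μ x₀ ≠ 0 := by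
    by_contra h; push Not at h; exact hne (funext h)
  obtain ⟨t₁, ht₁⟩ : ∃ t₁, kvec x₀ t₁ = true := by
    by_contra h; push Not at h
    exact kvec_ne_zero hn3 (hμ x₀ hx₀) (funext fun i => by simpa using h i)
  -- an even position `t₀ ≠ t₁` for the constant row and a third even position `j ∉ {t₀, t₁}` witnessing the split
  obtain ⟨t₀, j, hpar, h0j, h01, hj1⟩ : ∃ t₀ j : Fin n, par t₀ = par j ∧ t₀ ≠ j ∧ t₀ ≠ t₁ ∧ j ≠ t₁ := by
    obtain ⟨e₀, e₁, e₂, p01, p02, n01, n02, n12⟩ := three_even hn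
    by_cases h0 : e₀ = t₁
    · exact ⟨e₁, e₂, p01.symm.trans p02, n12, fun h => n01 (h0.trans h.symm), fun h => n02 (h0.trans h.symm)⟩
    · by_cases h1 : e₁ = t₁
      · exact ⟨e₀, e₂, p02, n02, h0, fun h => n12 (h1.trans h.symm)⟩
      · exact ⟨e₀, e₁, p01, n01, h0, h1⟩
  -- the affine row making the `t₁`-functional odd
  let κ : BFn n := fun x => if kvec x t₁ = true then 1 else 0
  have hκμ : (fun x => μ x * κ x) ≠ 0 := by
    intro h
    have := congrFun h x₀
    simp only [κ, ht₁, if_true, mul_one, Pi.zero_apply] at this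
    exact hx₀ this
  obtain ⟨R, hR, hR1⟩ : ∃ R ∈ lowDeg (ZMod 3) n 1, ∑ x, (μ x * κ x) * lev R x = 1 := by
    by_contra h; push Not at h
    refine hκμ (weights_eq_zero_of_orthogonal _ fun R hR => ?_)
    have h01 : ∀ a : ZMod 2, a ≠ 1 → a = 0 := by decide
    exact h01 _ (h R hR)
  have hsum : ∀ P : Fin n → CubeFn (ZMod 3) n,
      ∑ x, μ x * win P x = ∑ x, μ x * (1 + dz (kvec x) (ans P x) + sgn x) := by
    intro P
    refine Finset.sum_congr rfl fun x _ => ?_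
    by_cases hx : μ x = 0
    · simp [hx]
    · rw [win_eq hn3 (hμ x hx)]
  -- the two witnesses and their parities `Wa`, `Wa + 1`
  let Pa : Fin n → CubeFn (ZMod 3) n := oneRow t₀ 1
  let Pb : Fin n → CubeFn (ZMod 3) n := twoRow t₀ t₁ 1 R
  have hPa : ∀ i, Pa i ∈ lowDeg (ZMod 3) n D := fun i => by
    unfold Pa oneRow; split_ifs
    · exact one_mem_lowDeg D
    · exact Submodule.zero_mem _
  have hPb : ∀ i, Pb i ∈ lowDeg (ZMod 3) n D := twoRow_mem t₀ t₁ (one_mem_lowDeg D) (lowDeg_mono hD hR)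
  have hsa : SplitAtZero Pa := ⟨t₀, j, hpar, by simp [Pa, oneRow], by simp [Pa, oneRow, h0j.symm]⟩
  have hsb : SplitAtZero Pb := ⟨t₀, j, hpar, by simp [Pb, twoRow], by simp [Pb, twoRow, h0j.symm, hj1]⟩
  have hW : ∑ x, μ x * win Pb x = ∑ x, μ x * win Pa x + 1 := by
    rw [hsum, hsum, ← hR1, ← Finset.sum_add_distrib]
    refine Finset.sum_congr rfl fun x _ => ?_
    simp only [Pa, Pb]
    rw [dz_ans_oneRow, dz_ans_twoRow _ _ h01]
    ring
  by_cases hβ : β = ∑ x, μ x * win Pa x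
  · exact ⟨Pa, hPa, hsa, hβ.symm⟩
  · refine ⟨Pb, hPb, hsb, ?_⟩
    rw [hW]
    generalize ∑ x, μ x * win Pa x = W at hβ ⊢
    revert β W; decide

/-- ★ COROLLARY A′ (even lengths): no XOR certificate against the non-parity-local degree-`≤ D` strategies. -/
theorem xorCertificate_trivial_parity (hn : 5 ≤ n) {D : ℕ} (hD : 1 ≤ D) (r : ℕ) (μ : BFn n) (hμ : ∀ x, μ x ≠ 0 → OddZeros x)
    (β : ZMod 2) (h : ∀ P : Fin n → CubeFn (ZMod 3) n, (∀ i, P i ∈ lowDeg (ZMod 3) n D) → ¬ IsParityLocal r P → ∑ x, μ x * win P x = β) :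
    μ = 0 := by
  by_contra hne
  obtain ⟨P, hP, hs, hPβ⟩ := winParity_attains_split hn hD μ hμ hne (β + 1)
  have := h P hP (not_isParityLocal_of_split hs r)
  rw [hPβ] at this
  revert this; generalize β = b; revert b; decide

/-- ★ COROLLARY A′ (odd lengths): no XOR certificate against the non-offset-comb-local degree-`≤ D` strategies. -/
theorem xorCertificate_trivial_comb (hn : 5 ≤ n) {D : ℕ} (hD : 1 ≤ D) (r : ℕ) (μ : BFn n) (hμ : ∀ x, μ x ≠ 0 → OddZeros x)
    (β : ZMod 2) (h : ∀ P : Fin n → CubeFn (ZMod 3) n, (∀ i, P i ∈ lowDeg (ZMod 3) n D) → ¬ IsOffsetCombLocal r P → ∑ x, μ x * win P x = β) :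
    μ = 0 := by
  by_contra hne
  obtain ⟨P, hP, hs, hPβ⟩ := winParity_attains_split hn hD μ hμ hne (β + 1)
  have := h P hP (not_isOffsetCombLocal_of_split' (splitAtZero'_of_splitAtZero hs) r)
  rw [hPβ] at this
  revert this; generalize β = b; revert b; decide

/-- in particular (μ = a point mass): NO UNIVERSAL INPUT against the generic classes — every odd-class input is won by some degree-`≤ D`
strategy that splits at zero (`n ≥ 5`, `D ≥ 1`). -/
theorem no_universal_input_split (hn : 5 ≤ n) {D : ℕ} (hD : 1 ≤ D) {x : Fin n → Bool} (hx : OddZeros x) :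
    ∃ P : Fin n → CubeFn (ZMod 3) n, (∀ i, P i ∈ lowDeg (ZMod 3) n D) ∧ SplitAtZero P ∧ Rel x (ans P x) := by
  let μ : BFn n := fun y => if y = x then 1 else 0
  have hμ : ∀ y, μ y ≠ 0 → OddZeros y := fun y hy => by
    by_cases h : y = x
    · rw [h]; exact hx
    · simp [μ, h] at hy
  have hne : μ ≠ 0 := fun h => by simpa [μ] using congrFun h x
  obtain ⟨P, hP, hs, hβ⟩ := winParity_attains_split hn hD μ hμ hne 1
  refine ⟨P, hP, hs, ?_⟩
  have h1 : ∑ y, μ y * win P y = win P x := by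
    rw [Finset.sum_eq_single x (fun y _ hy => by simp [μ, hy]) (by simp)]; simp [μ]
  rw [h1] at hβ
  unfold win at hβ
  by_contra hR
  simp [hR] at hβ

/-! ### §7b Theorem B′ against the generic classes -/

/-- SPARSE REPAIR with a split: as `sparseRepair`, choosing the off-arc rows to be the constant `1` at position `L` and `0` elsewhere, so the
repaired (degree-`≤ D`) strategy splits at zero through the positions `L`, `L + 2`. -/
theorem sparse_family_split (hn : 3 ≤ n) {D : ℕ} (hD : 1 ≤ D) {L : ℕ} (hL : L + 3 ≤ n) (𝒳 : Finset (Fin n → Bool))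
    (hodd : ∀ x ∈ 𝒳, OddZeros x) (hoff : ∀ x ∈ 𝒳, ∀ k : Fin n, (k : ℕ) < L → x k = false) (hcard : 2 * 𝒳.card + 1 ≤ L) :
    ∃ P : Fin n → CubeFn (ZMod 3) n, (∀ i, P i ∈ lowDeg (ZMod 3) n D) ∧
      (P ⟨L, by omega⟩ (zer n) = 1 ∧ P ⟨L + 2, by omega⟩ (zer n) ≠ 1) ∧ ∀ x ∈ 𝒳, Rel x (ans P x) := by
  let Q : Fin n → CubeFn (ZMod 3) n := fun t => if (t : ℕ) = L then 1 else 0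
  obtain ⟨P, hoffP, harc, hwin⟩ := sparseRepair hn (show L ≤ n by omega) 𝒳 hodd hoff hcard Q
  refine ⟨P, fun i => ?_, ⟨?_, ?_⟩, hwin⟩
  · by_cases hi : (i : ℕ) < L
    · exact lowDeg_mono hD (harc i hi)
    · rw [hoffP i (by omega)]
      simp only [Q]; split_ifs
      · exact one_mem_lowDeg D
      · exact Submodule.zero_mem _
  · rw [hoffP _ (by simp)]; simp [Q]
  · rw [hoffP _ (by simp)]; simp [Q]

/-- a split (parity-free) survives conjugation by a rotation. -/
theorem splitAtZero'_conj (hn : 0 < n) (a : ℕ) {P : Fin n → CubeFn (ZMod 3) n} (h : SplitAtZero' P) : SplitAtZero' (conjStrat a P) := by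
  obtain ⟨i, j, hi, hj⟩ := h
  refine ⟨shift n a i, shift n a j, ?_, ?_⟩
  · rw [conjStrat_shift hn]; exact hi
  · rw [conjStrat_shift hn]; exact hj

/-- for EVEN `n` a shift preserves equality of parities. -/
theorem par_shift_eq (he : n % 2 = 0) (a : ℕ) {i j : Fin n} (h : par i = par j) : par (shift n a i) = par (shift n a j) := by
  simp only [par, shift, decide_eq_decide] at h ⊢
  have h2 : 2 ∣ n := Nat.dvd_of_mod_eq_zero he
  rw [Nat.mod_mod_of_dvd _ h2, Nat.mod_mod_of_dvd _ h2, Nat.add_mod, Nat.add_mod (j : ℕ)]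
  constructor
  · intro hi
    have : (i : ℕ) % 2 = (j : ℕ) % 2 := by omega
    rw [← this]; exact hi
  · intro hj
    have : (i : ℕ) % 2 = (j : ℕ) % 2 := by omega
    rw [this]; exact hj

/-- a split survives conjugation by a rotation when `n` is even. -/
theorem splitAtZero_conj (he : n % 2 = 0) (hn : 0 < n) (a : ℕ) {P : Fin n → CubeFn (ZMod 3) n} (h : SplitAtZero P) :
    SplitAtZero (conjStrat a P) := by
  obtain ⟨i, j, hp, hi, hj⟩ := h
  refine ⟨shift n a i, shift n a j, par_shift_eq he a hp, ?_, ?_⟩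
  · rw [conjStrat_shift hn]; exact hi
  · rw [conjStrat_shift hn]; exact hj

/-- sparse repair on ANY arc, with a split. -/
theorem sparse_family_split_arc (hn : 3 ≤ n) {D : ℕ} (hD : 1 ≤ D) (a : ℕ) {L : ℕ} (hL : L + 3 ≤ n)
    (𝒳 : Finset (Fin n → Bool)) (hodd : ∀ x ∈ 𝒳, OddZeros x)
    (hoff : ∀ x ∈ 𝒳, ∀ b : Fin n, (b : ℕ) < L → x (shift n a b) = false) (hcard : 2 * 𝒳.card + 1 ≤ L) :
    ∃ P : Fin n → CubeFn (ZMod 3) n, (∀ i, P i ∈ lowDeg (ZMod 3) n D) ∧ SplitAtZero' P ∧ (n % 2 = 0 → SplitAtZero P) ∧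
      ∀ x ∈ 𝒳, Rel x (ans P x) := by
  have hn0 : 0 < n := by omega
  let 𝒴 : Finset (Fin n → Bool) := 𝒳.image (rot a)
  have hY : ∀ y ∈ 𝒴, ∃ x ∈ 𝒳, y = rot a x := fun y hy => by
    obtain ⟨x, hx, rfl⟩ := Finset.mem_image.1 hy; exact ⟨x, hx, rfl⟩
  have hoddY : ∀ y ∈ 𝒴, OddZeros y := fun y hy => by
    obtain ⟨x, hx, rfl⟩ := hY y hy
    have h := hodd x hx
    unfold OddZeros at h ⊢
    rwa [show (univ.filter fun b : Fin n => rot a x b = false) = univ.filter fun b : Fin n => x (shift n a b) = false from rfl,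
      card_filter_shift a (fun b : Fin n => x b = false)]
  have hoffY : ∀ y ∈ 𝒴, ∀ b : Fin n, (b : ℕ) < L → y b = false := fun y hy b hb => by
    obtain ⟨x, hx, rfl⟩ := hY y hy; rw [rot_apply]; exact hoff x hx b hb
  have hYc : 𝒴.card ≤ 𝒳.card := Finset.card_image_le
  obtain ⟨P', hP', ⟨h1, h2⟩, hwin⟩ := sparse_family_split hn hD hL 𝒴 hoddY hoffY (by omega)
  have hs : SplitAtZero P' := ⟨⟨L, by omega⟩, ⟨L + 2, by omega⟩, by simp [par], h1, h2⟩
  refine ⟨conjStrat a P', conjStrat_mem a hP', splitAtZero'_conj hn0 a (splitAtZero'_of_splitAtZero hs),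
    fun he => splitAtZero_conj he hn0 a hs, fun x hx => ?_⟩
  have h := hwin (rot a x) (Finset.mem_image_of_mem _ hx)
  rw [← ans_conjStrat hn0 a P' x, rel_rot] at h
  exact h

/-- ★★ COROLLARY B′ against the GENERIC classes: for `n ≥ (M·w+1)(2M+1)` and `n ≥ 2M + 4`, ANY `M` odd-class inputs of weight `≤ w` are won
simultaneously by ONE degree-`≤ D` strategy (`D ≥ 1`) that splits at zero — so it is not offset-comb-local (any radius) and, when `n` is even, not
parity-local (any radius): no bounded family of test inputs certifies either generic leaf, at any weight. -/
theorem no_bounded_universal_family_split (M w : ℕ) {n : ℕ} (hn : 2 * M + 4 ≤ n) (hn' : (M * w + 1) * (2 * M + 1) ≤ n) {D : ℕ}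
    (hD : 1 ≤ D) (𝒳 : Finset (Fin n → Bool)) (hM : 𝒳.card ≤ M) (hX : ∀ x ∈ 𝒳, OddZeros x ∧ LightDial.wt x ≤ w) :
    ∃ P : Fin n → CubeFn (ZMod 3) n, (∀ i, P i ∈ lowDeg (ZMod 3) n D) ∧ (∀ r, ¬ IsOffsetCombLocal r P) ∧
      (n % 2 = 0 → ∀ r, ¬ IsParityLocal r P) ∧ ∀ x ∈ 𝒳, Rel x (ans P x) := by
  obtain ⟨a, _, hfree⟩ := exists_free_arc (L := 2 * M + 1) (by omega) hn' 𝒳 hM fun x hx => (hX x hx).2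
  obtain ⟨P, hP, hs', hs, hwin⟩ :=
    sparse_family_split_arc (by omega) hD a (L := 2 * M + 1) (by omega) 𝒳 (fun x hx => (hX x hx).1) hfree (by omega)
  exact ⟨P, hP, fun r => not_isOffsetCombLocal_of_split' hs' r, fun he r => not_isParityLocal_of_split (hs he) r, hwin⟩

/-- the dichotomy's generic side, stated for the EVEN generic class itself. -/
theorem generic_no_bounded_witness_parity (M w r : ℕ) {n : ℕ} (he : n % 2 = 0) (hn : 2 * M + 4 ≤ n)
    (hn' : (M * w + 1) * (2 * M + 1) ≤ n) {D : ℕ} (hD : 1 ≤ D) (𝒳 : Finset (Fin n → Bool)) (hM : 𝒳.card ≤ M)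
    (hX : ∀ x ∈ 𝒳, OddZeros x ∧ LightDial.wt x ≤ w) :
    ¬ ∀ P : Fin n → CubeFn (ZMod 3) n, (∀ i, P i ∈ lowDeg (ZMod 3) n D) → ¬ IsParityLocal r P → ∃ x ∈ 𝒳, ¬ Rel x (ans P x) := by
  intro h
  obtain ⟨P, hP, _, hpl, hwin⟩ := no_bounded_universal_family_split M w hn hn' hD 𝒳 hM hX
  obtain ⟨x, hx, hR⟩ := h P hP (hpl he r)
  exact hR (hwin x hx)

/-- … and for the ODD generic class itself. -/
theorem generic_no_bounded_witness_comb (M w r : ℕ) {n : ℕ} (hn : 2 * M + 4 ≤ n)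
    (hn' : (M * w + 1) * (2 * M + 1) ≤ n) {D : ℕ} (hD : 1 ≤ D) (𝒳 : Finset (Fin n → Bool)) (hM : 𝒳.card ≤ M)
    (hX : ∀ x ∈ 𝒳, OddZeros x ∧ LightDial.wt x ≤ w) :
    ¬ ∀ P : Fin n → CubeFn (ZMod 3) n, (∀ i, P i ∈ lowDeg (ZMod 3) n D) → ¬ IsOffsetCombLocal r P → ∃ x ∈ 𝒳, ¬ Rel x (ans P x) := by
  intro h
  obtain ⟨P, hP, hoc, _, hwin⟩ := no_bounded_universal_family_split M w hn hn' hD 𝒳 hM hX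
  obtain ⟨x, hx, hR⟩ := h P hP (hoc r)
  exact hR (hwin x hx)

end Summit.QuantumAdvantage.QuantumAdvantage.Theorems.CertDial
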